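import Summits.SmoothPoincare4.SmoothPoincare4.Theorems.CylinderEntropyCylinderRungTwoFluxIdentity
import Summits.SmoothPoincare4.SmoothPoincare4.Theorems.CylinderEntropyCylinderRungTwoHeightConstOfHorizontal
import Summits.SmoothPoincare4.SmoothPoincare4.Theorems.CylinderEntropyCylinderRungTwoSliceOfConstantHeight
import Summits.SmoothPoincare4.SmoothPoincare4.Theorems.CylinderEntropyCylinderRungTwoTiltExcessVanishing
import Literature.Geometry.Lorentzian.VolumePositivity
import Mathlib.MeasureTheory.Measure.OpenPos
import HarnessLib

/-!
# Route `CylinderEntropy`, crux `CylinderRungTwo` (stmt-SmoothPoincare4-7631), line `killing-flux`: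
# THE EQUALITY CASE OF THE AREA FLOOR (rigidity layer R2-G,
# registered helper `helper_sliceOfAreaEqFloor`)

Let `N = {z ∈ ℝ⁶ | ∑_{i<5} zᵢ² = 1} = S⁴ × ℝ`, `M` a compact connected boundaryless `4`-manifold and
`ι : M → ℝ⁶` a smooth embedding with image in `N` which SEPARATES THE TWO ENDS of `N` (no path in
`N ∖ ι(M)` from height `≤ -R` to height `≥ R`), with a continuous unit normal `ν` tangent to `N`.
The area floor says `μH⁴(ι(M)) ≥ μH⁴(S⁴)`; here we prove the EQUALITY CASE:

  `μH⁴(ι(M)) = μH⁴(S⁴)  ⟹  ι(M) = S⁴ × {c}` is a slice (`range ι = range (sliceMap c)`).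

## Proof (fact-free)

Let `μ = ι^* μH⁴ = Measure.comap ι μH⁴` be the pull-back area measure, a finite measure with
`μ(M) = μH⁴(ι(M))`.
1. FLUX. By the landed flux identity (`stub_fluxIdentity`, `…FluxIdentity.lean`)
   `|∫_M ν₅ dμ| = μH⁴(S⁴)`, while `|ν₅| ≤ ‖ν‖ = 1`; hence
   `μH⁴(S⁴) = |∫ ν₅ dμ| ≤ ∫ |ν₅| dμ ≤ ∫ 1 dμ = μ(M) = μH⁴(ι(M)) = μH⁴(S⁴)`, so
   `∫_M (1 - |ν₅|) dμ = 0` with a continuous nonnegative integrand: `1 - |ν₅| = 0` `μ`-a.e.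
   (`integral_one_sub_abs_eq_zero`).
2. POSITIVITY. `μ` charges every nonempty open set: Mathlib's normalisation `μHE⁴ = c • μH⁴`
   (`c ≠ 0`) and the area formula `c • ι^* μH⁴ = μ_g` (`g = ι^*δ`, landed
   `smul_comap_hausdorffMeasure_eq_riemannianMeasure`) reduce this to the positivity of the
   Riemannian measure on open sets (`isOpenPosMeasure_riemannianMeasure`, Federer 3.2.46); so the
   continuous function `1 - |ν₅|` vanishes identically (`Continuous.ae_eq_iff_eq`) and `ν₅² = 1`
   on `M` (`isOpenPosMeasure_comap_hausdorffMeasure`, `sq_apply_five_eq_one_of_area_eq`).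
3. HORIZONTAL ⟹ CONSTANT HEIGHT ⟹ SLICE: the landed helpers `helper_heightConstOfHorizontal`
   (a connected cross-section with `ν₅² ≡ 1` has constant height) and
   `helper_sliceOfConstantHeight` (a cross-section of constant height is a whole slice).

Everything here is PROVED (no `sorry`, no new definitions, no named facts).

References: H. Federer, *Geometric Measure Theory* (1969), 3.2.3 and 3.2.46 (area formula; the
Riemannian measure is the Hausdorff measure, positive on open sets); R. S. Hamilton, Comm. Anal.
Geom. 1 (1993) 127–137, §4 (horizontal slices of `S⁴ × ℝ`).
-/

-- the prescribed namespace `Summit.SmoothPoincare4.SmoothPoincare4.…` repeats `SmoothPoincare4`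
set_option linter.dupNamespace false

noncomputable section

open Set Function Filter MeasureTheory
open scoped Manifold ContDiff Topology ENNReal NNReal RealInnerProductSpace BigOperators
open Summit.SmoothPoincare4.SmoothPoincare4.Theorems.CylinderRungTwo.KillingFlux (stub_fluxIdentity
  measurableEmbedding_of_emb norm_nu mfderiv_injective_of_isSmoothEmbedding)
open Literature.Geometry.Riemannian.SphericalCylinderEntropy (hausdorffMeasure_sphere_four_lt_top)

namespace Summit.SmoothPoincare4.SmoothPoincare4.Cruxes.CylinderRungTwo.KillingFlux

open Literature.Geometry.Riemannian Literature.Geometry.Lorentzian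
  Literature.Geometry.Lorentzian.PseudoRiemannianMetric

/-! ## An abstract equality case -/

/-- **Abstract equality case.** On a finite measure space, if `|F| ≤ 1` pointwise, `F` is
integrable and `|∫ F dμ| = μ(univ)`, then `∫ (1 - |F|) dμ = 0`:
`μ(univ) = |∫ F| ≤ ∫ |F| ≤ ∫ 1 = μ(univ)`. [folklore] -/
theorem integral_one_sub_abs_eq_zero {X : Type*} [MeasurableSpace X] {μ : Measure X}
    [IsFiniteMeasure μ] {F : X → ℝ} (hFi : Integrable F μ) (hle : ∀ x, |F x| ≤ 1)
    (hflux : |∫ x, F x ∂μ| = (μ univ).toReal) :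
    ∫ x, (1 - |F x|) ∂μ = 0 := by
  have hint : Integrable (fun x => |F x|) μ := hFi.abs
  have hup : ∫ x, |F x| ∂μ ≤ (μ univ).toReal := by
    have h := integral_mono hint (integrable_const (1 : ℝ)) fun x => hle x
    rwa [integral_const, smul_eq_mul, mul_one, measureReal_def] at h
  have hlow : (μ univ).toReal ≤ ∫ x, |F x| ∂μ := by
    rw [← hflux]
    exact abs_integral_le_integral_abs
  rw [integral_sub (integrable_const (1 : ℝ)) hint, integral_const, smul_eq_mul, mul_one,
    measureReal_def]
  linarith

/-! ## The equality case of the area floor -/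

section AreaEqFloor

variable {M : Type} [TopologicalSpace M] [ChartedSpace (EuclideanSpace ℝ (Fin 4)) M]

/-- A smooth embedding `ι : M⁴ → ℝ⁶` is a (spacelike =) immersion for the Euclidean metric:
`⟪dι v, dι v⟫ > 0` for `v ≠ 0` because `dι` is injective
(`mfderiv_injective_of_isSmoothEmbedding`). [folklore] -/
theorem isSpacelikeImmersion_of_isSmoothEmbedding [IsManifold (𝓡 4) ∞ M]
    {ι : M → EuclideanSpace ℝ (Fin 6)} (hι : Manifold.IsSmoothEmbedding (𝓡 4) (𝓡 6) ∞ ι) :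
    (euclideanMetric (EuclideanSpace ℝ (Fin 6))).IsSpacelikeImmersion (𝓡 4) ι := by
  refine ⟨hι.contMDiff, fun y v hv => ?_⟩
  -- the tangent spaces of `ℝ⁶` are `ℝ⁶`; Mathlib deliberately provides no normed instances on
  -- `TangentSpace`, so we install the definitional ones locally (tree idiom)
  letI : NormedAddCommGroup (TangentSpace (𝓡 6) (ι y)) :=
    inferInstanceAs (NormedAddCommGroup (EuclideanSpace ℝ (Fin 6)))
  letI : InnerProductSpace ℝ (TangentSpace (𝓡 6) (ι y)) :=
    inferInstanceAs (InnerProductSpace ℝ (EuclideanSpace ℝ (Fin 6)))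
  rw [inducedBilin_apply, euclideanMetric_apply]
  have hne : mfderiv (𝓡 4) (𝓡 6) ι y v ≠ 0 := fun h =>
    hv (mfderiv_injective_of_isSmoothEmbedding hι y (by rw [h, map_zero]))
  exact real_inner_self_pos.mpr hne

/-- **The pull-back area measure `ι^* μH⁴` of a closed embedded `M⁴ ⊂ ℝ⁶` charges nonempty open
sets.** With Mathlib's normalisation `μHE⁴ = c • μH⁴` the area formula gives
`c • ι^* μH⁴ = μ_g`, the Riemannian measure of `g = ι^*δ`
(`smul_comap_hausdorffMeasure_eq_riemannianMeasure`), which is positive on nonempty open sets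
(`isOpenPosMeasure_riemannianMeasure`). [cite: Federer1969, §3.2.46] -/
theorem isOpenPosMeasure_comap_hausdorffMeasure [IsManifold (𝓡 4) ∞ M] [CompactSpace M]
    [T2Space M] [MeasurableSpace M] [BorelSpace M] {ι : M → EuclideanSpace ℝ (Fin 6)}
    (hι : Manifold.IsSmoothEmbedding (𝓡 4) (𝓡 6) ∞ ι) :
    (Measure.comap ι (μH[4] : Measure (EuclideanSpace ℝ (Fin 6)))).IsOpenPosMeasure := by
  have hspace := isSpacelikeImmersion_of_isSmoothEmbedding hι
  -- Mathlib's normalisation `μHE⁴ = c • μH⁴` and the area formula `c • ι^* μH⁴ = μ_g`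
  have hcμ := smul_comap_hausdorffMeasure_eq_riemannianMeasure hspace hι.isEmbedding.injective
    (Measure.euclideanHausdorffMeasure_def (X := EuclideanSpace ℝ (Fin 6)) 4)
  haveI := isOpenPosMeasure_riemannianMeasure
    ((euclideanMetric (EuclideanSpace ℝ (Fin 6))).inducedRiemannianMetric ι
      contMDiff_pullbackBilin_holds hspace)
  refine ⟨fun U hU hne h0 => ?_⟩
  refine hU.measure_ne_zero (riemannianMeasure
    ((euclideanMetric (EuclideanSpace ℝ (Fin 6))).inducedRiemannianMetric ι
      contMDiff_pullbackBilin_holds hspace)) hne ?_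
  rw [← hcμ, Measure.smul_apply, smul_eq_mul, h0, mul_zero]

/-- `|ν₅| ≤ 1` for a unit normal field `ν` (`|ν₅| ≤ ‖ν‖ = 1`). [folklore] -/
theorem abs_apply_five_le_one_of_isUnitNormal {ι ν : M → EuclideanSpace ℝ (Fin 6)}
    (hνn : (euclideanMetric (EuclideanSpace ℝ (Fin 6))).IsUnitNormal (𝓡 4) ι ν 1) (x : M) :
    |ν x 5| ≤ 1 := by
  have h := PiLp.norm_apply_le (ν x) (5 : Fin 6)
  rw [norm_nu hνn x, Real.norm_eq_abs] at h
  exact h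

/-- **Area equal to the floor forces horizontality.** For a compact connected embedded
cross-section `ι : M → N = S⁴ × ℝ` separating the ends, with continuous unit normal `ν` tangent to
`N`: if `μH⁴(ι(M)) = μH⁴(S⁴)` then `ν₅(x)² = 1` for every `x`. By the flux identity
`|∫ ν₅ d(ι^*μH⁴)| = μH⁴(S⁴) = μH⁴(ι(M)) = (ι^*μH⁴)(M)` and `|ν₅| ≤ 1`, the continuous
nonnegative function `1 - |ν₅|` has integral `0`, hence vanishes a.e., hence everywhere because
`ι^*μH⁴` charges nonempty open sets (`isOpenPosMeasure_comap_hausdorffMeasure`).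
[cite: Federer1969, §3.2.46] -/
theorem sq_apply_five_eq_one_of_area_eq [T2Space M] [SecondCountableTopology M]
    [IsManifold (𝓡 4) ∞ M] [CompactSpace M] [ConnectedSpace M] [MeasurableSpace M] [BorelSpace M]
    {ι : M → EuclideanSpace ℝ (Fin 6)} (hι : Manifold.IsSmoothEmbedding (𝓡 4) (𝓡 6) ∞ ι)
    (hN : ∀ x, ∑ i : Fin 5, ι x (Fin.castSucc i) ^ 2 = 1)
    (hsep : ∃ R : ℝ, ∀ a b : EuclideanSpace ℝ (Fin 6), ∑ i : Fin 5, a (Fin.castSucc i) ^ 2 = 1 →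
      ∑ i : Fin 5, b (Fin.castSucc i) ^ 2 = 1 → a 5 ≤ -R → R ≤ b 5 →
      ¬ JoinedIn ({z : EuclideanSpace ℝ (Fin 6) | ∑ i : Fin 5, z (Fin.castSucc i) ^ 2 = 1} \
        Set.range ι) a b)
    {ν : M → EuclideanSpace ℝ (Fin 6)} (hνc : Continuous ν)
    (hνn : (euclideanMetric (EuclideanSpace ℝ (Fin 6))).IsUnitNormal (𝓡 4) ι ν 1)
    (hνN : ∀ x, ∑ i : Fin 5, ν x (Fin.castSucc i) * ι x (Fin.castSucc i) = 0)
    (harea : μH[4] (Set.range ι) = μH[4] (Metric.sphere (0 : EuclideanSpace ℝ (Fin 5)) 1))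
    (x : M) : ν x 5 ^ 2 = 1 := by
  -- the flux identity
  have hflux := stub_fluxIdentity M ι hι hN hsep ν hνc hνn hνN
  -- the pull-back area measure, finite of total mass `μH⁴(ι(M)) = μH⁴(S⁴)`
  set μ : Measure M := Measure.comap ι (μH[4] : Measure (EuclideanSpace ℝ (Fin 6))) with hμ
  have huniv : μ univ = μH[4] (Metric.sphere (0 : EuclideanSpace ℝ (Fin 5)) 1) := by
    rw [hμ, (measurableEmbedding_of_emb hι).comap_apply, image_univ, harea]
  haveI : IsFiniteMeasure μ := ⟨by rw [huniv]; exact hausdorffMeasure_sphere_four_lt_top⟩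
  rw [← huniv] at hflux
  -- the integrand `1 - |ν₅|`: continuous, nonnegative, integrable, of integral zero
  have h5c : Continuous fun y => ν y 5 := (EuclideanSpace.proj (5 : Fin 6)).continuous.comp hνc
  have hle : ∀ y, |ν y 5| ≤ 1 := abs_apply_five_le_one_of_isUnitNormal hνn
  have hFi : Integrable (fun y => ν y 5) μ :=
    (integrable_const (1 : ℝ)).mono' h5c.aestronglyMeasurable
      (Eventually.of_forall fun y => by rw [Real.norm_eq_abs]; exact hle y)
  have hzero : ∫ y, (1 - |ν y 5|) ∂μ = 0 := integral_one_sub_abs_eq_zero hFi hle hflux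
  have hGc : Continuous fun y => 1 - |ν y 5| := continuous_const.sub (continuous_abs.comp h5c)
  have hGi : Integrable (fun y => 1 - |ν y 5|) μ := (integrable_const (1 : ℝ)).sub hFi.abs
  have hae : (fun y => 1 - |ν y 5|) =ᵐ[μ] 0 :=
    (integral_eq_zero_iff_of_nonneg (fun y => sub_nonneg.2 (hle y)) hGi).1 hzero
  -- `μ` charges nonempty open sets: `1 - |ν₅|` vanishes identically
  haveI : μ.IsOpenPosMeasure := isOpenPosMeasure_comap_hausdorffMeasure hι
  have hG0 : (fun y => 1 - |ν y 5|) = 0 := (hGc.ae_eq_iff_eq μ continuous_const).1 hae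
  have hx : 1 - |ν x 5| = 0 := congr_fun hG0 x
  have habs : |ν x 5| = 1 := by linarith
  rw [← sq_abs, habs, one_pow]

end AreaEqFloor

/-- **Registered helper `helper_sliceOfAreaEqFloor` of line `killing-flux` (rigidity layer R2-G:
the equality case of the area floor).** For a compact connected boundaryless `4`-manifold `M`, a
smooth embedding `ι : M → N = S⁴ × ℝ ⊂ ℝ⁶` separating the two ends of `N`, and a continuous unit
normal `ν` along `ι` tangent to `N`: if `μH⁴(ι(M)) = μH⁴(S⁴)` then `ι(M)` is a slice
`S⁴ × {c} = range (sliceMap c)`. Proof: the flux identity and `|ν₅| ≤ 1` force `|ν₅| ≡ 1`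
(`sq_apply_five_eq_one_of_area_eq`: `∫ (1 - |ν₅|) d(ι^*μH⁴) = 0` and `ι^*μH⁴` charges open sets);
a connected horizontal cross-section has constant height (`helper_heightConstOfHorizontal`), and a
cross-section of constant height is a whole slice (`helper_sliceOfConstantHeight`).
[cite: Hamilton1993, §4] -/
theorem helper_sliceOfAreaEqFloor :
    ∀ (M : Type) [TopologicalSpace M] [T2Space M] [SecondCountableTopology M]
      [ChartedSpace (EuclideanSpace ℝ (Fin 4)) M] [IsManifold (𝓡 4) ∞ M] [CompactSpace M]
      [ConnectedSpace M] [MeasurableSpace M] [BorelSpace M] (ι : M → EuclideanSpace ℝ (Fin 6)),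
      Manifold.IsSmoothEmbedding (𝓡 4) (𝓡 6) ∞ ι →
      (∀ x, ∑ i : Fin 5, ι x (Fin.castSucc i) ^ 2 = 1) →
      (∃ R : ℝ, ∀ a b : EuclideanSpace ℝ (Fin 6), ∑ i : Fin 5, a (Fin.castSucc i) ^ 2 = 1 →
        ∑ i : Fin 5, b (Fin.castSucc i) ^ 2 = 1 → a 5 ≤ -R → R ≤ b 5 →
        ¬ JoinedIn ({z : EuclideanSpace ℝ (Fin 6) | ∑ i : Fin 5, z (Fin.castSucc i) ^ 2 = 1} \
          Set.range ι) a b) →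
      ∀ ν : M → EuclideanSpace ℝ (Fin 6), Continuous ν →
        (Literature.Geometry.Riemannian.euclideanMetric
          (EuclideanSpace ℝ (Fin 6))).IsUnitNormal (𝓡 4) ι ν 1 →
        (∀ x, ∑ i : Fin 5, ν x (Fin.castSucc i) * ι x (Fin.castSucc i) = 0) →
        μH[4] (Set.range ι) = μH[4] (Metric.sphere (0 : EuclideanSpace ℝ (Fin 5)) 1) →
        ∃ c : ℝ, Set.range ι = Set.range (Literature.Geometry.Manifold.CylinderSlice.sliceMap c) := by
  intro M _ _ _ _ _ _ _ _ _ ι hι hN hsep ν hνc hνn hνN harea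
  -- horizontality everywhere, then constant height, then a whole slice
  have h2 : ∀ x, ν x 5 ^ 2 = 1 := sq_apply_five_eq_one_of_area_eq hι hN hsep hνc hνn hνN harea
  have hconst := helper_heightConstOfHorizontal M ι ν hι.contMDiff hνn h2
  obtain ⟨x₀⟩ : Nonempty M := inferInstance
  exact ⟨ι x₀ 5, (helper_sliceOfConstantHeight M ι hι hN (ι x₀ 5) fun x => hconst x x₀).1⟩

end Summit.SmoothPoincare4.SmoothPoincare4.Cruxes.CylinderRungTwo.KillingFlux

end
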